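import Literature.Computability.AlgebraicComplexity.OrbitClosureWeights
import HarnessLib

/-!
# Semi-invariants of binary forms: the Hessian source, an explicit two-row highest-weight vector
# of `k[Sym^n (k²)]`

Classical invariant theory of binary forms `f = ∑_p a_p x₀^p x₁^{n-p}` (Cayley, Sylvester, Hilbert):
the *source* (leading coefficient, "Quelle") of a covariant is a *semi-invariant*, i.e. an
invariant of the unipotent subgroup of `GL₂` times a torus eigenvector; the simplest one past the
leading coefficient `a₀` itself is the source of the Hessian covariant `f₀₀ f₁₁ - f₀₁²`,
`2n · a₀ a₂ - (n - 1) · a₁²` in the normalisation `a_p = coeff (x₀^p x₁^{n-p}) f`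
(Hilbert, *Theory of Algebraic Invariants*, Lectures I.8–I.9; Olver, *Classical Invariant Theory*,
Ch. 5–6; here `x₁` is the variable of HIGHEST index, the `B`-stable line of the column convention of
`linSubst`, so "leading" refers to the highest power of `x₁`).

In the conventions of the tree (`coordRep σ k n`: `GL(k^σ)` acting on the coordinate ring
`k[Sym^n (k^σ)] = MvPolynomial (DegIdx σ n) k` by `(g · F)(f) = F(g⁻¹ · f)`, highest weights for the
upper triangular Borel, weights of coordinate functions non-positive — `GLHighestWeight.lean`,
`OrbitCoordinateRing.lean`, `OrbitClosureWeights.lean`) this file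

* names the degree-`n` monomial indices `binIdx n p = x₀^p x₁^{n-p}` of `Sym^n (k²)` and the
  bijection `binIdxEquiv n : Fin (n+1) ≃ DegIdx (Fin 2) n` (§1);
* computes the action of an upper triangular `g ∈ GL₂` on the coordinate functions
  `X_{x₀^p x₁^{n-p}}` for `p ≤ 2` (§2, `coordSubst_X_binIdx_zero/one/two`: with `β = g⁻¹`,
  `X_{x₁^n} ↦ β₁₁^n X_{x₁^n}`, `X_{x₀x₁^{n-1}} ↦ β₀₀β₁₁^{n-1} X_{x₀x₁^{n-1}} + n β₀₁β₁₁^{n-1} X_{x₁^n}`, …),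
  from the binomial expansion of `β · x₀^{e₀} x₁^{e₁} = (β₀₀x₀)^{e₀} (β₀₁x₀ + β₁₁x₁)^{e₁}`
  (`coeff_binIdx_linSubst_monomial`);
* defines the **Hessian source** `hessianSource k n = 2n · X_{x₁^n} X_{x₀²x₁^{n-2}} - (n-1) · X_{x₀x₁^{n-1}}²`
  (§3) and PROVES that for `n ≥ 2` it is a highest-weight vector of `coordRep (Fin 2) k n` of weight
  `(-2, -(2n-2)) = λ^*`, `λ = (2n-2, 2)` (`hessianSource_mem_highestWeightSpace`): the explicit
  two-row highest-weight vector of the plethysm `Sym²(Sym^n k²) ⊇ V_{(2n-2,2)}`, over any field.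

It is written to be TRANSPORTED: by the inheritance lemma `rename_mem_highestWeightSpace_coordRep`
(`NotViaSaturationsChowProofs.lean`) along the embedding of `Fin 2` onto the two greatest indices of
any finite linear order `σ`, `hessianSource` gives an explicit highest-weight vector of weight
`(0,…,0,-2,-(2n-2))` of `k[Sym^n (k^σ)]`, a "seed" for the padded-permanent constructions of
`Summits/ValiantsHypothesis/…/ValuativeGCTValuativeFlipSeedLift*.lean`.

Mathlib has binomial expansions (`add_pow`) and `MvPolynomial` coefficients but no invariant theory
of binary forms; nothing here is specific to characteristic zero.
-/

noncomputable section

open MvPolynomial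
open scoped BigOperators

namespace Literature.Computability.AlgebraicComplexity

variable {k : Type*} [Field k]

/-! ### §1 Degree-`n` monomials in two variables -/

/-- The degree-`n` monomial `x₀^p x₁^{n-p}` of `k[x₀, x₁]` as a coordinate index of `Sym^n (k²)`
(junk value `x₀^n` for `p > n`, through `min p n`). [folklore] -/
def binIdx (n p : ℕ) : DegIdx (Fin 2) n :=
  ⟨Finsupp.single 0 (min p n) + Finsupp.single 1 (n - p), by
    rw [mem_degMonomials_iff, map_add, Finsupp.degree_single, Finsupp.degree_single]
    omega⟩

/-- The exponent of `x₀` in `binIdx n p` is `min p n`. [folklore] -/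
@[simp]
theorem binIdx_apply_zero (n p : ℕ) : (binIdx n p).1 0 = min p n := by
  simp [binIdx]

/-- The exponent of `x₁` in `binIdx n p` is `n - p`. [folklore] -/
@[simp]
theorem binIdx_apply_one (n p : ℕ) : (binIdx n p).1 1 = n - p := by
  simp [binIdx]

/-- The two exponents of a degree-`n` monomial in two variables add up to `n`. [folklore] -/
theorem degIdx_fin_two_add (n : ℕ) (e : DegIdx (Fin 2) n) : e.1 0 + e.1 1 = n := by
  have h := mem_degMonomials_iff.mp e.2
  rw [Finsupp.degree_eq_sum, Fin.sum_univ_two] at h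
  exact h

/-- Every degree-`n` monomial in two variables is `x₀^p x₁^{n-p}` with `p` its `x₀`-exponent.
[folklore] -/
theorem eq_binIdx {n : ℕ} (e : DegIdx (Fin 2) n) : e = binIdx n (e.1 0) := by
  have h := degIdx_fin_two_add n e
  apply Subtype.ext
  rw [DFunLike.ext_iff, Fin.forall_fin_two, binIdx_apply_zero, binIdx_apply_one]
  omega

/-- The bijection `p ↦ x₀^p x₁^{n-p}` between `{0, …, n}` and the degree-`n` monomials in two
variables. [folklore] -/
def binIdxEquiv (n : ℕ) : Fin (n + 1) ≃ DegIdx (Fin 2) n where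
  toFun p := binIdx n p
  invFun e := ⟨e.1 0, Nat.lt_succ_of_le (by have := degIdx_fin_two_add n e; omega)⟩
  left_inv p := by
    apply Fin.ext
    simp only [binIdx_apply_zero]
    have := p.2
    omega
  right_inv e := (eq_binIdx e).symm

/-- Unfolding lemma for `binIdxEquiv`. [folklore] -/
@[simp]
theorem binIdxEquiv_apply (n : ℕ) (p : Fin (n + 1)) : binIdxEquiv n p = binIdx n p :=
  rfl

/-- A sum over the degree-`n` monomials in two variables is a sum over `p = 0, …, n`. [folklore] -/
theorem sum_degIdx_fin_two_eq_sum_range {M : Type*} [AddCommMonoid M] (n : ℕ)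
    (F : DegIdx (Fin 2) n → M) : ∑ e, F e = ∑ p ∈ Finset.range (n + 1), F (binIdx n p) := by
  rw [← Equiv.sum_comp (binIdxEquiv n)]
  exact Fin.sum_univ_eq_sum_range (fun p => F (binIdx n p)) (n + 1)

/-! ### §2 The action of an upper triangular matrix on the coordinate functions -/

/-- An upper triangular substitution on a monomial in two variables:
`β · x₀^{e₀} x₁^{e₁} = (β₀₀ x₀)^{e₀} (β₀₁ x₀ + β₁₁ x₁)^{e₁}` (column convention `x_i ↦ ∑_j β_{ji} x_j`,
`β₁₀ = 0`). [folklore] -/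
theorem linSubst_monomial_fin_two (β : Matrix (Fin 2) (Fin 2) k) (hβ : β 1 0 = 0) (e : Fin 2 →₀ ℕ) :
    linSubst (Fin 2) k β (monomial e 1) =
      (C (β 0 0) * X 0) ^ e 0 * (C (β 0 1) * X 0 + C (β 1 1) * X 1) ^ e 1 := by
  have he : monomial e (1 : k) = X 0 ^ e 0 * X 1 ^ e 1 := by
    rw [monomial_eq, C_1, one_mul, Finsupp.prod_fintype _ _ (fun i => pow_zero _), Fin.prod_univ_two]
  rw [he, map_mul, map_pow, map_pow, linSubst_X, linSubst_X, Fin.sum_univ_two, Fin.sum_univ_two, hβ,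
    zero_smul, add_zero, smul_eq_C_mul, smul_eq_C_mul, smul_eq_C_mul]

/-- **Coefficients of the substituted monomial.**  For `β` upper triangular, `e₀ + e₁ = n` and
`p ≤ n`, the coefficient of `x₀^p x₁^{n-p}` in `β · x₀^{e₀} x₁^{e₁}` is
`C(e₁, p - e₀) β₀₀^{e₀} β₀₁^{p-e₀} β₁₁^{n-p}` if `e₀ ≤ p` and `0` otherwise (binomial expansion of
`(β₀₁ x₀ + β₁₁ x₁)^{e₁}`). [folklore] -/
theorem coeff_binIdx_linSubst_monomial (β : Matrix (Fin 2) (Fin 2) k) (hβ : β 1 0 = 0) {n : ℕ}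
    (e : Fin 2 →₀ ℕ) (he : e 0 + e 1 = n) {p : ℕ} (hp : p ≤ n) :
    coeff (binIdx n p).1 (linSubst (Fin 2) k β (monomial e 1)) =
      if e 0 ≤ p then ((e 1).choose (p - e 0) : k) * β 0 0 ^ e 0 * β 0 1 ^ (p - e 0) * β 1 1 ^ (n - p)
      else 0 := by
  rw [linSubst_monomial_fin_two β hβ e, add_pow, Finset.mul_sum, coeff_sum]
  -- each summand is a monomial
  have hCX : ∀ (a : k) (j : Fin 2) (r : ℕ),
      (C a * X j : MvPolynomial (Fin 2) k) ^ r = monomial (Finsupp.single j r) (a ^ r) := by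
    intro a j r
    rw [mul_pow, ← C_pow, X_pow_eq_monomial, C_mul_monomial, mul_one]
  have hterm : ∀ i ∈ Finset.range (e 1 + 1),
      (C (β 0 0) * X 0 : MvPolynomial (Fin 2) k) ^ e 0 *
        ((C (β 0 1) * X 0) ^ i * (C (β 1 1) * X 1) ^ (e 1 - i) * ((e 1).choose i : MvPolynomial (Fin 2) k)) =
      monomial (Finsupp.single 0 (e 0 + i) + Finsupp.single 1 (e 1 - i))
        (((e 1).choose i : k) * β 0 0 ^ e 0 * β 0 1 ^ i * β 1 1 ^ (e 1 - i)) := by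
    intro i _
    rw [hCX, hCX, hCX, ← map_natCast (C : k →+* MvPolynomial (Fin 2) k) ((e 1).choose i), C_apply,
      monomial_mul, monomial_mul, monomial_mul]
    congr 1
    · congr 1
      rw [add_zero, Finsupp.single_add]
      abel
    · ring
  rw [Finset.sum_congr rfl fun i hi => by rw [hterm i hi, coeff_monomial]]
  -- which summand carries the monomial `x₀^p x₁^{n-p}`
  have hiff : ∀ i, i ≤ e 1 →
      (Finsupp.single 0 (e 0 + i) + Finsupp.single 1 (e 1 - i) = (binIdx n p).1 ↔
        e 0 ≤ p ∧ i = p - e 0) := by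
    intro i hi
    rw [DFunLike.ext_iff, Fin.forall_fin_two]
    simp
    omega
  split_ifs with h0
  · rw [Finset.sum_eq_single (p - e 0)]
    · rw [if_pos ((hiff _ (by omega)).mpr ⟨h0, rfl⟩)]
      have h1 : e 1 - (p - e 0) = n - p := by omega
      rw [h1]
    · intro i hi hne
      rw [if_neg]
      intro h
      exact hne ((hiff i (by simpa [Nat.lt_succ_iff] using hi)).mp h).2
    · intro h
      exfalso
      apply h
      rw [Finset.mem_range]
      omega
  · refine Finset.sum_eq_zero fun i hi => ?_
    rw [if_neg]
    intro h
    exact h0 ((hiff i (by simpa [Nat.lt_succ_iff] using hi)).mp h).1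

/-- **The action of an upper triangular `g ∈ GL₂` on the coordinate function `X_{x₀^p x₁^{n-p}}`**
(`p ≤ n`; `coordRep`, `(g · F)(f) = F(g⁻¹ · f)`): with `β = g⁻¹`,
`g · X_{x₀^p x₁^{n-p}} = ∑_{q ≤ p} C(n-q, p-q) β₀₀^q β₀₁^{p-q} β₁₁^{n-p} · X_{x₀^q x₁^{n-q}}` — only the
coordinates of monomials with at most `p` factors `x₀` occur (the flag of `x₁`-leading coefficients
is `B`-stable). [folklore] -/
theorem coordSubst_X_binIdx (n : ℕ) {g : GL (Fin 2) k}
    (hg : Literature.NumberTheory.DiophantineGeometry.IsUpperTriangular g) {p : ℕ} (hp : p ≤ n) :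
    coordSubst n g (X (binIdx n p)) =
      ∑ q ∈ Finset.range (p + 1),
        ((((n - q).choose (p - q) : ℕ) : k) * ((g⁻¹ : GL (Fin 2) k) : Matrix (Fin 2) (Fin 2) k) 0 0 ^ q *
          ((g⁻¹ : GL (Fin 2) k) : Matrix (Fin 2) (Fin 2) k) 0 1 ^ (p - q) *
          ((g⁻¹ : GL (Fin 2) k) : Matrix (Fin 2) (Fin 2) k) 1 1 ^ (n - p)) • X (binIdx n q) := by
  set β : Matrix (Fin 2) (Fin 2) k := ((g⁻¹ : GL (Fin 2) k) : Matrix (Fin 2) (Fin 2) k) with hβ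
  have hβ10 : β 1 0 = 0 :=
    ((Literature.NumberTheory.DiophantineGeometry.borelSubgroup (Fin 2) k).inv_mem hg).apply_eq_zero
      (show (0 : Fin 2) < 1 by decide)
  have hcoef : ∀ q, q ≤ n →
      coeff (binIdx n p).1 (linSubstRep (Fin 2) k g⁻¹ (monomial (binIdx n q).1 1)) =
        if q ≤ p then (((n - q).choose (p - q) : ℕ) : k) * β 0 0 ^ q * β 0 1 ^ (p - q) * β 1 1 ^ (n - p)
        else 0 := by
    intro q hq
    rw [linSubstRep_apply, ← hβ, coeff_binIdx_linSubst_monomial β hβ10 _ (degIdx_fin_two_add n _) hp,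
      binIdx_apply_zero, binIdx_apply_one, min_eq_left hq]
  rw [coordSubst_X, sum_degIdx_fin_two_eq_sum_range,
    ← Finset.sum_subset (Finset.range_subset_range.mpr (Nat.succ_le_succ hp))]
  · refine Finset.sum_congr rfl fun q hq => ?_
    have hqp : q ≤ p := Nat.lt_succ_iff.mp (Finset.mem_range.mp hq)
    rw [hcoef q (hqp.trans hp), if_pos hqp]
  · intro q hq hq'
    have hqn : q ≤ n := Nat.lt_succ_iff.mp (Finset.mem_range.mp hq)
    have hqp : ¬ q ≤ p := fun h => hq' (Finset.mem_range.mpr (Nat.lt_succ_of_le h))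
    rw [hcoef q hqn, if_neg hqp, zero_smul]

/-- `g · X_{x₁^n} = β₁₁^n X_{x₁^n}` (`β = g⁻¹`): the coordinate of the leading monomial spans a
`B`-stable line. [folklore] -/
theorem coordSubst_X_binIdx_zero (n : ℕ) {g : GL (Fin 2) k}
    (hg : Literature.NumberTheory.DiophantineGeometry.IsUpperTriangular g) :
    coordSubst n g (X (binIdx n 0)) =
      (((g⁻¹ : GL (Fin 2) k) : Matrix (Fin 2) (Fin 2) k) 1 1 ^ n) • X (binIdx n 0) := by
  rw [coordSubst_X_binIdx n hg (Nat.zero_le n), Finset.sum_range_one]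
  simp

/-- `g · X_{x₀x₁^{n-1}} = n β₀₁β₁₁^{n-1} X_{x₁^n} + β₀₀β₁₁^{n-1} X_{x₀x₁^{n-1}}` (`β = g⁻¹`, `1 ≤ n`).
[folklore] -/
theorem coordSubst_X_binIdx_one {n : ℕ} (hn : 1 ≤ n) {g : GL (Fin 2) k}
    (hg : Literature.NumberTheory.DiophantineGeometry.IsUpperTriangular g) :
    coordSubst n g (X (binIdx n 1)) =
      ((n : k) * ((g⁻¹ : GL (Fin 2) k) : Matrix (Fin 2) (Fin 2) k) 0 1 *
          ((g⁻¹ : GL (Fin 2) k) : Matrix (Fin 2) (Fin 2) k) 1 1 ^ (n - 1)) • X (binIdx n 0) +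
        (((g⁻¹ : GL (Fin 2) k) : Matrix (Fin 2) (Fin 2) k) 0 0 *
          ((g⁻¹ : GL (Fin 2) k) : Matrix (Fin 2) (Fin 2) k) 1 1 ^ (n - 1)) • X (binIdx n 1) := by
  rw [coordSubst_X_binIdx n hg hn, Finset.sum_range_succ, Finset.sum_range_one]
  simp [Nat.choose_one_right]

/-- `g · X_{x₀²x₁^{n-2}} = C(n,2) β₀₁²β₁₁^{n-2} X_{x₁^n} + (n-1) β₀₀β₀₁β₁₁^{n-2} X_{x₀x₁^{n-1}}
 + β₀₀²β₁₁^{n-2} X_{x₀²x₁^{n-2}}` (`β = g⁻¹`, `2 ≤ n`). [folklore] -/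
theorem coordSubst_X_binIdx_two {n : ℕ} (hn : 2 ≤ n) {g : GL (Fin 2) k}
    (hg : Literature.NumberTheory.DiophantineGeometry.IsUpperTriangular g) :
    coordSubst n g (X (binIdx n 2)) =
      (((n.choose 2 : ℕ) : k) * ((g⁻¹ : GL (Fin 2) k) : Matrix (Fin 2) (Fin 2) k) 0 1 ^ 2 *
          ((g⁻¹ : GL (Fin 2) k) : Matrix (Fin 2) (Fin 2) k) 1 1 ^ (n - 2)) • X (binIdx n 0) +
        ((((n - 1 : ℕ) : k)) * ((g⁻¹ : GL (Fin 2) k) : Matrix (Fin 2) (Fin 2) k) 0 0 *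
          ((g⁻¹ : GL (Fin 2) k) : Matrix (Fin 2) (Fin 2) k) 0 1 *
          ((g⁻¹ : GL (Fin 2) k) : Matrix (Fin 2) (Fin 2) k) 1 1 ^ (n - 2)) • X (binIdx n 1) +
        (((g⁻¹ : GL (Fin 2) k) : Matrix (Fin 2) (Fin 2) k) 0 0 ^ 2 *
          ((g⁻¹ : GL (Fin 2) k) : Matrix (Fin 2) (Fin 2) k) 1 1 ^ (n - 2)) • X (binIdx n 2) := by
  rw [coordSubst_X_binIdx n hg hn, Finset.sum_range_succ, Finset.sum_range_succ, Finset.sum_range_one]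
  have h1 : (n - 1).choose (2 - 1) = n - 1 := by rw [Nat.choose_one_right]
  simp [h1]

/-! ### §3 The Hessian source -/

variable (k)

/-- **The Hessian source** of binary `n`-ics, as a polynomial function on `Sym^n (k²)`:
`2n · X_{x₁^n} X_{x₀²x₁^{n-2}} - (n-1) · X_{x₀x₁^{n-1}}²`, i.e. `2n·a₀a₂ - (n-1)·a₁²` in the coefficients
`a_p = coeff (x₀^p x₁^{n-p})` — the leading (`x₁^{2n-4}`-) coefficient of the Hessian covariant
`f₀₀f₁₁ - f₀₁²` divided by `n - 1`.  Meaningful for `n ≥ 2` (for `n < 2` the index `x₀²x₁^{n-2}` is the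
junk value of `binIdx`). Hilbert, *Theory of Algebraic Invariants* I.8; Olver, *Classical Invariant
Theory* Ch. 5. [folklore] -/
def hessianSource (n : ℕ) : MvPolynomial (DegIdx (Fin 2) n) k :=
  (2 * (n : k)) • (X (binIdx n 0) * X (binIdx n 2)) - ((n : k) - 1) • X (binIdx n 1) ^ 2

variable {k}

/-- The value of the Hessian source at a coefficient vector `a`: `2n a₀a₂ - (n-1) a₁²`
(`a_p` the coordinate at `x₀^p x₁^{n-p}`). [folklore] -/
theorem aeval_hessianSource (n : ℕ) (a : DegIdx (Fin 2) n → k) :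
    aeval a (hessianSource k n) =
      2 * (n : k) * (a (binIdx n 0) * a (binIdx n 2)) - ((n : k) - 1) * a (binIdx n 1) ^ 2 := by
  simp [hessianSource, Algebra.smul_def]

/-- The Hessian source is a form of degree `2` in the coefficients. [folklore] -/
theorem isHomogeneous_hessianSource (n : ℕ) : (hessianSource k n).IsHomogeneous 2 := by
  have h1 : (C (2 * (n : k)) * (X (binIdx n 0) * X (binIdx n 2)) :
      MvPolynomial (DegIdx (Fin 2) n) k).IsHomogeneous 2 := by
    have := (isHomogeneous_C _ (2 * (n : k))).mul
      ((isHomogeneous_X k (binIdx n 0)).mul (isHomogeneous_X k (binIdx n 2)))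
    simpa using this
  have h2 : (C ((n : k) - 1) * X (binIdx n 1) ^ 2 : MvPolynomial (DegIdx (Fin 2) n) k).IsHomogeneous 2 := by
    have := (isHomogeneous_C _ ((n : k) - 1)).mul ((isHomogeneous_X k (binIdx n 1)).pow 2)
    simpa using this
  rw [hessianSource, smul_eq_C_mul, smul_eq_C_mul]
  exact h1.sub h2

/-- **The Hessian source is a highest-weight vector of weight `(2n-2, 2)^* = (-2, -(2n-2))`** of
`k[Sym^n (k²)]` (`coordRep (Fin 2) k n`), for `n ≥ 2`, over any field: for `g ∈ GL₂` upper
triangular with `β = g⁻¹`, substituting §2 into `2n·X_aX_c - (n-1)·X_b²` returns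
`β₁₁^{2n-2}β₀₀² · (2n·X_aX_c - (n-1)·X_b²)` because the `β₀₁`-terms cancel by `2·C(n,2) = n(n-1)`,
and `β₀₀²β₁₁^{2n-2} = g₀₀^{-2} g₁₁^{-(2n-2)}` is the weight character.  Classically: the source of a
covariant is a semi-invariant (Hilbert, *Theory of Algebraic Invariants*, Lecture I.9; Olver,
*Classical Invariant Theory*, Ch. 6, Roberts' theorem). [folklore] -/
theorem hessianSource_mem_highestWeightSpace {n : ℕ} (hn : 2 ≤ n) :
    hessianSource k n ∈ Literature.NumberTheory.DiophantineGeometry.highestWeightSpace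
      (coordRep (Fin 2) k n) ![(-2 : ℤ), -(2 * (n : ℤ) - 2)] := by
  intro g hg
  obtain ⟨n, rfl⟩ : ∃ n', n = n' + 2 := ⟨n - 2, by omega⟩
  have h00 : ((g⁻¹ : GL (Fin 2) k) : Matrix (Fin 2) (Fin 2) k) 0 0 = ((g : Matrix (Fin 2) (Fin 2) k) 0 0)⁻¹ :=
    inv_apply_diag_of_isUpperTriangular' hg 0
  have h11 : ((g⁻¹ : GL (Fin 2) k) : Matrix (Fin 2) (Fin 2) k) 1 1 = ((g : Matrix (Fin 2) (Fin 2) k) 1 1)⁻¹ :=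
    inv_apply_diag_of_isUpperTriangular' hg 1
  -- the weight character is `β₀₀² β₁₁^{2n+2}`, `β = g⁻¹`
  have hw : Literature.NumberTheory.DiophantineGeometry.weightChar
      ![(-2 : ℤ), -(2 * ((n + 2 : ℕ) : ℤ) - 2)] g =
      ((g⁻¹ : GL (Fin 2) k) : Matrix (Fin 2) (Fin 2) k) 0 0 ^ 2 *
        ((g⁻¹ : GL (Fin 2) k) : Matrix (Fin 2) (Fin 2) k) 1 1 ^ (2 * n + 2) := by
    rw [Literature.NumberTheory.DiophantineGeometry.weightChar, Fin.prod_univ_two]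
    simp only [Matrix.cons_val_zero, Matrix.cons_val_one]
    rw [show (-(2 * ((n + 2 : ℕ) : ℤ) - 2)) = -((2 * n + 2 : ℕ) : ℤ) by push_cast; ring,
      show (-2 : ℤ) = -((2 : ℕ) : ℤ) by norm_num, zpow_neg, zpow_neg, zpow_natCast, zpow_natCast,
      h00, h11, inv_pow, inv_pow]
  rw [coordRep_apply, hw, hessianSource, map_sub, map_smul, map_smul, map_mul, map_pow,
    coordSubst_X_binIdx_zero _ hg, coordSubst_X_binIdx_one (by omega) hg,
    coordSubst_X_binIdx_two (by omega) hg, show n + 2 - 1 = n + 1 from rfl,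
    show n + 2 - 2 = n from rfl]
  -- `2 · C(n+2, 2) = (n+2)(n+1)`
  have h2 : (n + 2).choose 2 * 2 = (n + 2) * (n + 1) := by
    have hdvd : 2 ∣ (n + 2) * (n + 1) := by
      rw [show (n + 2) * (n + 1) = (n + 1) * (n + 1 + 1) by ring]
      exact (Nat.even_mul_succ_self (n + 1)).two_dvd
    rw [Nat.choose_two_right, show n + 2 - 1 = n + 1 from rfl]
    exact Nat.div_mul_cancel hdvd
  have hchR : (((n + 2).choose 2 : ℕ) : MvPolynomial (DegIdx (Fin 2) (n + 2)) k) * 2 =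
      ((n : MvPolynomial (DegIdx (Fin 2) (n + 2)) k) + 2) * ((n : MvPolynomial (DegIdx (Fin 2) (n + 2)) k) + 1) := by
    have := congrArg (Nat.cast : ℕ → MvPolynomial (DegIdx (Fin 2) (n + 2)) k) h2
    simpa only [Nat.cast_mul, Nat.cast_add, Nat.cast_ofNat, Nat.cast_one] using this
  simp only [smul_eq_C_mul, map_mul, map_pow, map_natCast, map_sub, map_add, map_ofNat, map_one,
    Nat.cast_add, Nat.cast_ofNat, Nat.cast_one]
  linear_combination (C (((g⁻¹ : GL (Fin 2) k) : Matrix (Fin 2) (Fin 2) k) 1 1) ^ (2 * n + 2) *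
    C (((g⁻¹ : GL (Fin 2) k) : Matrix (Fin 2) (Fin 2) k) 0 1) ^ 2 *
    (X (binIdx (n + 2) 0) : MvPolynomial (DegIdx (Fin 2) (n + 2)) k) ^ 2 *
    ((n : MvPolynomial (DegIdx (Fin 2) (n + 2)) k) + 2)) * hchR

end Literature.Computability.AlgebraicComplexity
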